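import Literature.Computability.AlgebraicComplexity.InterfaceTensors
import HarnessLib

/-!
# Level-`ℓ` block triples, position classes `S_{i,j,k}`, compatibility and usefulness
(Vassilevska Williams–Xu–Xu–Zhou 2024, §5.2–§5.6: Defs. 5.8, 5.10, 5.12, Claim 5.9, Claim 5.11) — definitions and proofs

Topic `Literature/Computability/AlgebraicComplexity`.  The bookkeeping of the global stage (§5) of
Vassilevska Williams–Xu–Xu–Zhou, *New bounds for matrix multiplication: from alpha to omega* (SODA
2024, arXiv:2307.07970), on top of `InterfaceTensors.lean` (chunked variables
`x : Fin n → Fin c → Fin (q+2)` of `(CW_q^{⊗c})^{⊗n}`, `c = 2^{ℓ-1}`, level-1 sequences `levelSeq`,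
level-`ℓ` sequences `chunkLevels`, complete split distributions `completeSplitOn` = `split(·, S)`):

* **Block triples** (§3.8/§5.2): level-`ℓ` index sequences `I, J, K : Fin n → ℕ` with
  `I_t + J_t + K_t = 2^ℓ` (`IsLevelTriple c I J K`, `2^ℓ = 2c`); every non-zero entry of the power
  lies in a block triple (`isLevelTriple_of_ne_zero`), indeed its level-1 sequences add up to `2`
  entrywise (`levelSeq_add_of_ne_zero`).
* **Position classes** (§5.3): `S_{i,j,k} = {t | I_t = i, J_t = j, K_t = k}` (`posClass`) and
  `S_{*,*,k} = {t | K_t = k}` (`posClassZ`), with the fibrewise decomposition of `S_{*,*,k}` over `i`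
  (`card_filter_posClassZ_eq_sum`) and the resulting **averaging identity for split distributions**
  `split(K̂, S_{*,*,k}) · |S_{*,*,k}| = ∑_i split(K̂, S_{i,2c-k-i,k}) · |S_{i,2c-k-i,k}|`
  (`completeSplitOn_posClassZ_mul_card`; the computation "the third constraint implies the first"
  in the proof of Claim 5.11 and the one after Def. 5.15).
* **Usefulness, typicalness, compatibility** (Defs. 5.10, 5.12, 5.8) of a level-1 `Z`-sequence `K̂`
  for a triple, for data `α` (a distribution on constituent triples) and `γ_Z` (complete split
  distributions `γ_{Z,i,j,k}`), with `γ̄_{Z,*,*,k}` (`gammaBarZ`) as printed; `IsAlphaConsistent`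
  (`|S_{i,j,k}| = α(i,j,k) · n`, "consistent with `α`").  PROVED: a useful `K̂` of an `α`-consistent
  triple is typical (`IsUsefulFor.isTypical`, the displayed computation of the proof of Claim 5.11),
  hence compatible (`IsUsefulFor.isCompatibleWith`).
* **Claim 5.9, the structural core** (`levelSeq_eq_rev_of_chunkLevels_eq_zero`,
  `completeSplitOn_eq_rev_of_chunkLevels_eq_zero`, `compatible_fst_of_useful`): in the support of the
  power, on the chunks where the `Y`-block has level `0` the level-1 `Z`-chunk is `2⃗ −` the level-1
  `X`-chunk, so `split(K̂, S_{i,0,k})(L) = split(Î, S_{i,0,k})(2⃗ − L)`; with Remark 5.2's convention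
  `γ_{Z,i,0,k}(L) = γ_{X,i,0,k}(2⃗ − L)` (and symmetrically for `i = 0`), usefulness of `Î` and `Ĵ`
  gives the first item of compatibility of `K̂`.
* **Claim 5.11, the identification** (`usefulSubtensor_eq_interfaceTensor`): the sub-tensor of the
  power over a block triple `X_I Y_J Z_K` keeping exactly the level-1 blocks useful for it (in all
  three dimensions) IS the level-`ℓ` interface tensor `𝒯*` of Def. 4.1 with term map
  `t ↦ (I_t, J_t, K_t)` and parameters `(i, j, k, γ_{X,i,j,k}, γ_{Y,i,j,k}, γ_{Z,i,j,k})` — in the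
  coordinates of `InterfaceTensors.lean` this is an identity of zero-outs.

Everything is proved; the definitions are the paper's (with the non-emptiness guard of
`InterfaceTensors.lean` on position classes that do not occur, where `split(·, ∅)` is undefined in
the paper); no named facts.

## References

* V. Vassilevska Williams, Y. Xu, Z. Xu, R. Zhou, *New bounds for matrix multiplication: from alpha
  to omega*, SODA 2024, arXiv:2307.07970 (held: `paper:arxiv-2307.07970`): §3.8 (block triples),
  §5.2 (consistency with `α`), §5.3 (`S_{i,j,k}`, `S_{*,*,k}`, `γ̄_{Z,*,*,k}`, Def. 5.8, Claim 5.9),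
  §5.4, §5.5 (Def. 5.10, Claim 5.11 and its proof), §5.6 (Def. 5.12, Def. 5.15), Remark 5.2.
  [VassilevskaWilliamsXuXuZhou2024]
-/

noncomputable section

open scoped BigOperators
open Finset

namespace Literature.Computability.AlgebraicComplexity

open Literature.Barriers.MatrixMultiplication (bigCwTensor)

universe u

/-! ## Block triples and position classes -/

section PosClass

variable {n : ℕ}

/-- **A level-`ℓ` block triple** `X_I Y_J Z_K`: `I_t + J_t + K_t = 2^ℓ` (`= 2c`) for all `t` — the
only triples of level-`ℓ` blocks on which the power is non-zero. [cite: VassilevskaWilliamsXuXuZhou2024, §3.8 ("X_I, Y_J, Z_K form a nonzero subtensor when I_t + J_t + K_t = 2^ℓ")] -/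
def IsLevelTriple (c : ℕ) (I J K : Fin n → ℕ) : Prop := ∀ t, I t + J t + K t = 2 * c

/-- **The position class `S_{i,j,k} = {t ∈ [n] | I_t = i, J_t = j, K_t = k}`** of a block triple.
[cite: VassilevskaWilliamsXuXuZhou2024, §5.3 (S_{i,j,k})] -/
def posClass (I J K : Fin n → ℕ) (i j k : ℕ) : Finset (Fin n) :=
  univ.filter fun t => I t = i ∧ J t = j ∧ K t = k

/-- **The position class `S_{*,*,k} = {t ∈ [n] | K_t = k}`** of a level-`ℓ` `Z`-block.
[cite: VassilevskaWilliamsXuXuZhou2024, §5.3 (S_{*,*,k})] -/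
def posClassZ (K : Fin n → ℕ) (k : ℕ) : Finset (Fin n) := univ.filter fun t => K t = k

/-- Membership in `S_{i,j,k}`. [cite: VassilevskaWilliamsXuXuZhou2024, §5.3] -/
@[simp] theorem mem_posClass {I J K : Fin n → ℕ} {i j k : ℕ} {t : Fin n} :
    t ∈ posClass I J K i j k ↔ I t = i ∧ J t = j ∧ K t = k := by
  simp [posClass]

/-- Membership in `S_{*,*,k}`. [cite: VassilevskaWilliamsXuXuZhou2024, §5.3] -/
@[simp] theorem mem_posClassZ {K : Fin n → ℕ} {k : ℕ} {t : Fin n} : t ∈ posClassZ K k ↔ K t = k := by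
  simp [posClassZ]

/-- `S_{i,j,k} ⊆ S_{*,*,k}`. [cite: VassilevskaWilliamsXuXuZhou2024, §5.3] -/
theorem posClass_subset_posClassZ (I J K : Fin n → ℕ) (i j k : ℕ) : posClass I J K i j k ⊆ posClassZ K k := by
  intro t ht
  rw [mem_posClass] at ht
  exact mem_posClassZ.2 ht.2.2

/-- In a block triple the class `S_{i,j,k}` is empty unless `i + j + k = 2c`. [cite: VassilevskaWilliamsXuXuZhou2024, §5.3] -/
theorem posClass_eq_empty {c : ℕ} {I J K : Fin n → ℕ} (h : IsLevelTriple c I J K) {i j k : ℕ}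
    (hijk : i + j + k ≠ 2 * c) : posClass I J K i j k = ∅ := by
  ext t
  constructor
  · intro ht
    exfalso
    obtain ⟨h1, h2, h3⟩ := mem_posClass.1 ht
    apply hijk
    rw [← h1, ← h2, ← h3]
    exact h t
  · intro ht
    exact absurd ht (by simp)

/-- In a block triple, the part of `S_{*,*,k}` where `I_t = i` is `S_{i, 2c-k-i, k}`. [cite: VassilevskaWilliamsXuXuZhou2024, §5.3] -/
theorem filter_posClassZ_eq_posClass {c : ℕ} {I J K : Fin n → ℕ} (h : IsLevelTriple c I J K) (k i : ℕ) :
    ((posClassZ K k).filter fun t => I t = i) = posClass I J K i (2 * c - k - i) k := by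
  ext t
  simp only [mem_filter, mem_posClassZ, mem_posClass]
  have := h t
  constructor
  · rintro ⟨hk, hi⟩
    exact ⟨hi, by omega, hk⟩
  · rintro ⟨hi, -, hk⟩
    exact ⟨hk, hi⟩

/-- **Fibrewise decomposition of `S_{*,*,k}`**: for any predicate on positions,
`#{t ∈ S_{*,*,k} | p t} = ∑_{i ≤ 2c} #{t ∈ S_{i,2c-k-i,k} | p t}` (the classes `S_{i,j,k}`,
`i + j = 2c − k`, partition `S_{*,*,k}`). [cite: VassilevskaWilliamsXuXuZhou2024, §5.3 and Def. 5.15 ("S_{+,+,k} = ⋃ S_{i,j,k}")] -/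
theorem card_filter_posClassZ_eq_sum {c : ℕ} {I J K : Fin n → ℕ} (h : IsLevelTriple c I J K) (k : ℕ)
    (p : Fin n → Prop) [DecidablePred p] :
    ((posClassZ K k).filter p).card =
      ∑ i ∈ range (2 * c + 1), ((posClass I J K i (2 * c - k - i) k).filter p).card := by
  rw [card_eq_sum_card_fiberwise (f := I) (s := (posClassZ K k).filter p) (t := range (2 * c + 1))]
  · refine sum_congr rfl fun i _ => ?_
    rw [filter_filter, ← filter_posClassZ_eq_posClass h k i, filter_filter]
    congr 1
    ext t
    simp only [mem_filter, and_comm]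
  · intro t ht
    rw [Finset.mem_coe, mem_filter] at ht
    have := h t
    exact Finset.mem_coe.2 (mem_range.2 (by omega))

/-- In particular `|S_{*,*,k}| = ∑_i |S_{i,2c-k-i,k}|`. [cite: VassilevskaWilliamsXuXuZhou2024, §5.3] -/
theorem card_posClassZ_eq_sum {c : ℕ} {I J K : Fin n → ℕ} (h : IsLevelTriple c I J K) (k : ℕ) :
    (posClassZ K k).card = ∑ i ∈ range (2 * c + 1), (posClass I J K i (2 * c - k - i) k).card := by
  have := card_filter_posClassZ_eq_sum h k (fun _ => True)
  simpa using this

end PosClass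

/-! ## Split distributions on unions of position classes -/

section SplitAvg

variable {c n : ℕ}

/-- `split(Î, S)(σ) · |S| = #{t ∈ S | Î_t = σ}` (also for `S = ∅`, both sides being `0`). [cite: VassilevskaWilliamsXuXuZhou2024, Def. 3.5] -/
theorem completeSplitOn_mul_card (I : Fin n → Fin c → Fin 3) (S : Finset (Fin n)) (σ : Fin c → Fin 3) :
    completeSplitOn I S σ * S.card = ((S.filter fun t => I t = σ).card : ℝ) := by
  rw [completeSplitOn_apply]
  rcases Nat.eq_zero_or_pos S.card with h0 | hpos
  · have hS : S = ∅ := card_eq_zero.1 h0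
    simp [hS]
  · have hc : (S.card : ℝ) ≠ 0 := by exact_mod_cast hpos.ne'
    rw [div_mul_cancel₀ _ hc]

/-- **The averaging identity** `split(K̂, S_{*,*,k}) · |S_{*,*,k}| = ∑_i split(K̂, S_{i,2c-k-i,k}) · |S_{i,2c-k-i,k}|`
(the split distribution on `S_{*,*,k}` is the `|S_{i,j,k}|`-weighted average of those on the classes;
for an `α`-consistent triple the weights are `α(i,j,k)`, proof of Claim 5.11:
"`split(K̂, S_{*,*,k}) = (1/∑ α(i,j,k)) ∑ α(i,j,k) · split(K̂, S_{i,j,k})`").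
[cite: VassilevskaWilliamsXuXuZhou2024, Claim 5.11 (proof) and Def. 5.15 (discussion)] -/
theorem completeSplitOn_posClassZ_mul_card {I J K : Fin n → ℕ} (h : IsLevelTriple c I J K)
    (Kh : Fin n → Fin c → Fin 3) (k : ℕ) (σ : Fin c → Fin 3) :
    completeSplitOn Kh (posClassZ K k) σ * (posClassZ K k).card =
      ∑ i ∈ range (2 * c + 1), completeSplitOn Kh (posClass I J K i (2 * c - k - i) k) σ *
        (posClass I J K i (2 * c - k - i) k).card := by
  rw [completeSplitOn_mul_card, card_filter_posClassZ_eq_sum h k]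
  push_cast
  exact sum_congr rfl fun i _ => (completeSplitOn_mul_card Kh _ σ).symm

end SplitAvg

/-! ## The data of the global stage: `α`, `γ_Z`, `γ̄_{Z,*,*,k}`; usefulness, typicalness, compatibility -/

section Compatibility

variable {c n : ℕ}

/-- **`γ̄_{Z,*,*,k} = (1/∑_{i+j=2^ℓ-k} α(i,j,k)) ∑_{i+j=2^ℓ-k} α(i,j,k) · γ_{Z,i,j,k}`**, the average complete
split distribution of the constituent tensors with third coordinate `k`.  Implementation note: the
sums run over `i ∈ {0,…,2c}` with `j = 2c − k − i` truncated in `ℕ`, so for `i > 2c − k` they contain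
the extra terms `α(i, 0, k) γ_{Z,i,0,k}` resp. `α(i, 0, k)` with `i + k > 2c`; these vanish for every
`α` supported on the constituent triples `{i + j + k = 2c}` (and are forced to vanish by
`IsAlphaConsistent`, the corresponding classes `S_{i,0,k}` being empty, `posClass_eq_empty`), so
for such `α` this is exactly the printed `γ̄_{Z,*,*,k}`.
[cite: VassilevskaWilliamsXuXuZhou2024, §5.3 (γ̄_{Z,*,*,k})] -/
def gammaBarZ (c : ℕ) (α : ℕ × ℕ × ℕ → ℝ) (γZ : ℕ × ℕ × ℕ → (Fin c → Fin 3) → ℝ) (k : ℕ) :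
    (Fin c → Fin 3) → ℝ := fun σ =>
  (∑ i ∈ range (2 * c + 1), α (i, 2 * c - k - i, k) * γZ (i, 2 * c - k - i, k) σ) /
    ∑ i ∈ range (2 * c + 1), α (i, 2 * c - k - i, k)

/-- **A block triple consistent with `α`** (§5.2): every constituent class has exactly
`|S_{i,j,k}| = α(i,j,k) · n` positions (the joint type of `t ↦ (I_t, J_t, K_t)` is `α`).
[cite: VassilevskaWilliamsXuXuZhou2024, §5.2 ("block triples that are consistent with α")] -/
def IsAlphaConsistent (α : ℕ × ℕ × ℕ → ℝ) (I J K : Fin n → ℕ) : Prop :=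
  ∀ i j k, ((posClass I J K i j k).card : ℝ) = α (i, j, k) * n

/-- **Def. 5.10 (usefulness)**: the level-1 `Z`-block `Z_K̂` is useful for the triple `X_I Y_J Z_K`
if `split(K̂, S_{i,j,k}) = γ_{Z,i,j,k}` for all (occurring) `(i,j,k)`. [cite: VassilevskaWilliamsXuXuZhou2024, Def. 5.10] -/
def IsUsefulFor (γZ : ℕ × ℕ × ℕ → (Fin c → Fin 3) → ℝ) (I J K : Fin n → ℕ) (Kh : Fin n → Fin c → Fin 3) : Prop :=
  ∀ i j k, (posClass I J K i j k).Nonempty → completeSplitOn Kh (posClass I J K i j k) = γZ (i, j, k)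

/-- **Def. 5.12 (typicalness)**: `Z_K̂ ∈ Z_K` is typical if `split(K̂, S_{*,*,k}) = γ̄_{Z,*,*,k}` for
every (occurring) `k`. [cite: VassilevskaWilliamsXuXuZhou2024, Def. 5.12] -/
def IsTypical (c : ℕ) (α : ℕ × ℕ × ℕ → ℝ) (γZ : ℕ × ℕ × ℕ → (Fin c → Fin 3) → ℝ) (K : Fin n → ℕ)
    (Kh : Fin n → Fin c → Fin 3) : Prop :=
  ∀ k, (posClassZ K k).Nonempty → completeSplitOn Kh (posClassZ K k) = gammaBarZ c α γZ k

/-- **Def. 5.8 (compatibility)**: `Z_K̂ ∈ Z_K` is compatible with the triple `X_I Y_J Z_K` if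
(1) `split(K̂, S_{i,j,k}) = γ_{Z,i,j,k}` for all (occurring) `(i,j,k)` with `i = 0` or `j = 0`, and
(2) `split(K̂, S_{*,*,k}) = γ̄_{Z,*,*,k}` for every `k` (typicalness). [cite: VassilevskaWilliamsXuXuZhou2024, Def. 5.8] -/
def IsCompatibleWith (c : ℕ) (α : ℕ × ℕ × ℕ → ℝ) (γZ : ℕ × ℕ × ℕ → (Fin c → Fin 3) → ℝ)
    (I J K : Fin n → ℕ) (Kh : Fin n → Fin c → Fin 3) : Prop :=
  (∀ i j k, (i = 0 ∨ j = 0) → (posClass I J K i j k).Nonempty →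
      completeSplitOn Kh (posClass I J K i j k) = γZ (i, j, k)) ∧
    IsTypical c α γZ K Kh

/-- **A useful block of an `α`-consistent triple is typical** (proof of Claim 5.11: "the third
constraint implies the first constraint, because … `split(K̂, S_{*,*,k}) = (1/∑ α) ∑ α · split(K̂, S_{i,j,k})
= (1/∑ α) ∑ α · γ_{Z,i,j,k} = γ̄_{Z,*,*,k}`"). [cite: VassilevskaWilliamsXuXuZhou2024, Claim 5.11 (proof)] -/
theorem IsUsefulFor.isTypical {α : ℕ × ℕ × ℕ → ℝ} {γZ : ℕ × ℕ × ℕ → (Fin c → Fin 3) → ℝ}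
    {I J K : Fin n → ℕ} {Kh : Fin n → Fin c → Fin 3} (hlev : IsLevelTriple c I J K)
    (hα : IsAlphaConsistent α I J K) (hu : IsUsefulFor γZ I J K Kh) : IsTypical c α γZ K Kh := by
  intro k hk
  funext σ
  have hn : (n : ℝ) ≠ 0 := by
    obtain ⟨t, _⟩ := hk
    have : 0 < n := Fin.pos t
    exact_mod_cast this.ne'
  have hcardZ : ((posClassZ K k).card : ℝ) =
      (∑ i ∈ range (2 * c + 1), α (i, 2 * c - k - i, k)) * n := by
    rw [card_posClassZ_eq_sum hlev k]
    push_cast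
    rw [sum_mul]
    exact sum_congr rfl fun i _ => hα _ _ _
  have hpos : (0 : ℝ) < (posClassZ K k).card := by exact_mod_cast hk.card_pos
  have hden : (∑ i ∈ range (2 * c + 1), α (i, 2 * c - k - i, k)) ≠ 0 := by
    intro h0
    rw [h0, zero_mul] at hcardZ
    exact hpos.ne' hcardZ
  -- the averaging identity, with `split(K̂, S_{i,j,k}) = γ_{Z,i,j,k}` on the occurring classes
  have havg := completeSplitOn_posClassZ_mul_card hlev Kh k σ
  have hterm : ∀ i ∈ range (2 * c + 1),
      completeSplitOn Kh (posClass I J K i (2 * c - k - i) k) σ * (posClass I J K i (2 * c - k - i) k).card =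
        α (i, 2 * c - k - i, k) * γZ (i, 2 * c - k - i, k) σ * n := by
    intro i _
    rcases (posClass I J K i (2 * c - k - i) k).eq_empty_or_nonempty with he | hne
    · have h0 : α (i, 2 * c - k - i, k) * n = 0 := by rw [← hα, he, card_empty, Nat.cast_zero]
      rw [he, card_empty, Nat.cast_zero, mul_zero, mul_assoc, mul_comm (γZ _ σ), ← mul_assoc, h0, zero_mul]
    · rw [hu _ _ _ hne, hα]
      ring
  rw [sum_congr rfl hterm, hcardZ, ← sum_mul, ← mul_assoc] at havg
  have := mul_right_cancel₀ hn havg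
  simp only [gammaBarZ]
  rw [eq_div_iff hden]
  exact this

/-- Hence **a useful block of an `α`-consistent triple is compatible with it**. [cite: VassilevskaWilliamsXuXuZhou2024, Claim 5.11 (proof)] -/
theorem IsUsefulFor.isCompatibleWith {α : ℕ × ℕ × ℕ → ℝ} {γZ : ℕ × ℕ × ℕ → (Fin c → Fin 3) → ℝ}
    {I J K : Fin n → ℕ} {Kh : Fin n → Fin c → Fin 3} (hlev : IsLevelTriple c I J K)
    (hα : IsAlphaConsistent α I J K) (hu : IsUsefulFor γZ I J K Kh) : IsCompatibleWith c α γZ I J K Kh :=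
  ⟨fun i j k _ hne => hu i j k hne, hu.isTypical hlev hα⟩

end Compatibility

/-! ## The chunk structure of the support of the power (Claim 5.9) -/

section Support

variable (K : Type u) [CommSemiring K] (q : ℕ) {c n : ℕ}

/-- In the support of `(CW_q^{⊗c})^{⊗n}` the levels add up to `2` at every position. [cite: VassilevskaWilliamsXuXuZhou2024, §3.8 ("Î_t + Ĵ_t + K̂_t = 2 for all t")] -/
theorem levelSeq_add_of_ne_zero {x y z : Fin n → Fin c → Fin (q + 2)}
    (h : kroneckerPow (kroneckerPow (bigCwTensor K q) c) n x y z ≠ 0) (t : Fin n) (p : Fin c) :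
    (levelSeq x t p : ℕ) + levelSeq y t p + levelSeq z t p = 2 := by
  rw [kroneckerPow_apply] at h
  have ht : kroneckerPow (bigCwTensor K q) c (x t) (y t) (z t) ≠ 0 := fun h0 =>
    h (prod_eq_zero (mem_univ t) h0)
  rw [kroneckerPow_apply] at ht
  simpa using bigCw_block_support K (x t) (y t) (z t) ht p

/-- Hence the level-`ℓ` sequences of a supported entry form a block triple. [cite: VassilevskaWilliamsXuXuZhou2024, §3.8] -/
theorem isLevelTriple_of_ne_zero {x y z : Fin n → Fin c → Fin (q + 2)}
    (h : kroneckerPow (kroneckerPow (bigCwTensor K q) c) n x y z ≠ 0) :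
    IsLevelTriple c (chunkLevels (levelSeq x)) (chunkLevels (levelSeq y)) (chunkLevels (levelSeq z)) := by
  intro t
  simp only [chunkLevels_apply, patternLevel]
  rw [← sum_add_distrib, ← sum_add_distrib]
  calc ∑ p, ((levelSeq x t p : ℕ) + levelSeq y t p + levelSeq z t p) = ∑ _p : Fin c, 2 :=
        sum_congr rfl fun p _ => levelSeq_add_of_ne_zero K q h t p
    _ = 2 * c := by simp [mul_comm]

/-- A chunk shape of level `0` is the zero shape. [cite: VassilevskaWilliamsXuXuZhou2024, Claim 5.9 (proof: "J_t = 0 … implies Ĵ-chunk = 0⃗")] -/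
theorem pattern_eq_zero_of_patternLevel_eq_zero {σ : Fin c → Fin 3} (h : patternLevel σ = 0) (p : Fin c) :
    σ p = 0 := by
  unfold patternLevel at h
  have := (sum_eq_zero_iff.1 h) p (mem_univ p)
  exact Fin.ext this

/-- **Claim 5.9, the core**: in the support of the power, on a chunk where the `Y`-block has level `0`
the level-1 `Z`-chunk is `2⃗ −` the level-1 `X`-chunk. [cite: VassilevskaWilliamsXuXuZhou2024, Claim 5.9 (proof)] -/
theorem levelSeq_eq_rev_of_chunkLevels_eq_zero {x y z : Fin n → Fin c → Fin (q + 2)}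
    (h : kroneckerPow (kroneckerPow (bigCwTensor K q) c) n x y z ≠ 0) {t : Fin n}
    (ht : chunkLevels (levelSeq y) t = 0) : levelSeq z t = fun p => (levelSeq x t p).rev := by
  funext p
  have h0 : levelSeq y t p = 0 := pattern_eq_zero_of_patternLevel_eq_zero (by simpa using ht) p
  have h2 := levelSeq_add_of_ne_zero K q h t p
  rw [h0] at h2
  apply Fin.ext
  rw [Fin.val_rev]
  have := (levelSeq x t p).isLt
  simp only [Fin.val_zero, add_zero] at h2
  omega

/-- Symmetrically, where the `X`-block has level `0` the level-1 `Z`-chunk is `2⃗ −` the level-1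
`Y`-chunk. [cite: VassilevskaWilliamsXuXuZhou2024, Claim 5.9 (proof, "similarly with i = 0")] -/
theorem levelSeq_eq_rev_of_chunkLevels_eq_zero' {x y z : Fin n → Fin c → Fin (q + 2)}
    (h : kroneckerPow (kroneckerPow (bigCwTensor K q) c) n x y z ≠ 0) {t : Fin n}
    (ht : chunkLevels (levelSeq x) t = 0) : levelSeq z t = fun p => (levelSeq y t p).rev := by
  funext p
  have h0 : levelSeq x t p = 0 := pattern_eq_zero_of_patternLevel_eq_zero (by simpa using ht) p
  have h2 := levelSeq_add_of_ne_zero K q h t p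
  rw [h0] at h2
  apply Fin.ext
  rw [Fin.val_rev]
  have := (levelSeq y t p).isLt
  simp only [Fin.val_zero, zero_add] at h2
  omega

variable {K q}

/-- Complete split distributions only depend on the sequence on `S`. [cite: VassilevskaWilliamsXuXuZhou2024, Def. 3.5] -/
theorem completeSplitOn_congr_on {I I' : Fin n → Fin c → Fin 3} {S : Finset (Fin n)}
    (h : ∀ t ∈ S, I t = I' t) : completeSplitOn I S = completeSplitOn I' S := by
  funext σ
  simp only [completeSplitOn_apply]
  rw [Finset.filter_congr (p := fun u => I u = σ) (q := fun u => I' u = σ) fun t ht => by rw [h t ht]]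

/-- `split(2⃗ − Î, S)(σ) = split(Î, S)(2⃗ − σ)` for a sequence reversed on `S`. [cite: VassilevskaWilliamsXuXuZhou2024, Claim 5.9 (proof)] -/
theorem completeSplitOn_rev_on {I Z : Fin n → Fin c → Fin 3} {S : Finset (Fin n)}
    (h : ∀ t ∈ S, Z t = fun p => (I t p).rev) (σ : Fin c → Fin 3) :
    completeSplitOn Z S σ = completeSplitOn I S (fun p => (σ p).rev) := by
  simp only [completeSplitOn_apply]
  rw [Finset.filter_congr (p := fun u => Z u = σ) (q := fun u => I u = fun p => (σ p).rev) ?_]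
  intro t ht
  rw [h t ht]
  constructor
  · intro hz; funext p
    have := congrFun hz p
    rw [← this, Fin.rev_rev]
  · intro hi; funext p
    rw [hi, Fin.rev_rev]

variable (K q)

/-- **Claim 5.9, as split distributions**: in the support of the power with block triple `(I, J, K)`,
`split(K̂, S_{i,0,k})(L) = split(Î, S_{i,0,k})(2⃗ − L)`. [cite: VassilevskaWilliamsXuXuZhou2024, Claim 5.9 (proof: "split(K̂, S_{i,j,k})(L) = split(Î, S_{i,j,k})(2⃗ − L)")] -/
theorem completeSplitOn_eq_rev_of_chunkLevels_eq_zero {x y z : Fin n → Fin c → Fin (q + 2)}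
    (h : kroneckerPow (kroneckerPow (bigCwTensor K q) c) n x y z ≠ 0) (i k : ℕ) (σ : Fin c → Fin 3) :
    completeSplitOn (levelSeq z)
        (posClass (chunkLevels (levelSeq x)) (chunkLevels (levelSeq y)) (chunkLevels (levelSeq z)) i 0 k) σ =
      completeSplitOn (levelSeq x)
        (posClass (chunkLevels (levelSeq x)) (chunkLevels (levelSeq y)) (chunkLevels (levelSeq z)) i 0 k)
        (fun p => (σ p).rev) :=
  completeSplitOn_rev_on (fun _ ht => levelSeq_eq_rev_of_chunkLevels_eq_zero K q h (mem_posClass.1 ht).2.1) σ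

/-- **Claim 5.9** (the first item of compatibility after the compatibility zero-out I): in the support
of the power with block triple `(I, J, K)`, if `Î` is useful for the `X`-data and `Ĵ` for the
`Y`-data, and the `Z`-data satisfies Remark 5.2's convention `γ_{Z,i,0,k}(L) = γ_{X,i,0,k}(2⃗ − L)`,
`γ_{Z,0,j,k}(L) = γ_{Y,0,j,k}(2⃗ − L)`, then `split(K̂, S_{i,j,k}) = γ_{Z,i,j,k}` for every occurring
class with `i = 0` or `j = 0`. [cite: VassilevskaWilliamsXuXuZhou2024, Claim 5.9] -/
theorem compatible_fst_of_useful {γX γY γZ : ℕ × ℕ × ℕ → (Fin c → Fin 3) → ℝ}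
    (hZX : ∀ i k σ, γZ (i, 0, k) σ = γX (i, 0, k) (fun p => (σ p).rev))
    (hZY : ∀ j k σ, γZ (0, j, k) σ = γY (0, j, k) (fun p => (σ p).rev))
    {x y z : Fin n → Fin c → Fin (q + 2)}
    (h : kroneckerPow (kroneckerPow (bigCwTensor K q) c) n x y z ≠ 0)
    (hx : IsUsefulFor γX (chunkLevels (levelSeq x)) (chunkLevels (levelSeq y)) (chunkLevels (levelSeq z)) (levelSeq x))
    (hy : IsUsefulFor γY (chunkLevels (levelSeq x)) (chunkLevels (levelSeq y)) (chunkLevels (levelSeq z)) (levelSeq y))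
    (i j k : ℕ) (hij : i = 0 ∨ j = 0)
    (hne : (posClass (chunkLevels (levelSeq x)) (chunkLevels (levelSeq y)) (chunkLevels (levelSeq z)) i j k).Nonempty) :
    completeSplitOn (levelSeq z)
        (posClass (chunkLevels (levelSeq x)) (chunkLevels (levelSeq y)) (chunkLevels (levelSeq z)) i j k) =
      γZ (i, j, k) := by
  rcases hij with rfl | rfl
  · -- `i = 0`: `K̂`-chunks are the reversed `Ĵ`-chunks
    funext σ
    rw [completeSplitOn_rev_on (I := levelSeq y)
      (fun _ ht => levelSeq_eq_rev_of_chunkLevels_eq_zero' K q h (mem_posClass.1 ht).1) σ, hy 0 j k hne, hZY]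
  · -- `j = 0`: `K̂`-chunks are the reversed `Î`-chunks
    funext σ
    rw [completeSplitOn_rev_on (I := levelSeq x)
      (fun _ ht => levelSeq_eq_rev_of_chunkLevels_eq_zero K q h (mem_posClass.1 ht).2.1) σ, hx i 0 k hne, hZX]

end Support

/-! ## Claim 5.11: the useful sub-tensor over a block triple is the interface tensor `𝒯*` -/

section Identification

variable (R : Type u) [CommSemiring R] (q : ℕ) {c n : ℕ}

/-- The term map of a block triple: chunk `t` goes to the constituent class `(I_t, J_t, K_t)`,
enumerated by `Fin |{(i,j,k) | i+j+k = 2c}|`. [cite: VassilevskaWilliamsXuXuZhou2024, §5.5 (the parameter list of 𝒯*, indexed by i+j+k = 2^ℓ)] -/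
def tripleTermMap {I J K : Fin n → ℕ} (h : IsLevelTriple c I J K) : Fin n → Fin (constituentTriples c).card :=
  fun t => (constituentTriples c).equivFin ⟨(I t, J t, K t), (mem_constituentTriples c).2 (h t)⟩

/-- The parameter list of `𝒯*`: for the class `(i,j,k)`, the constituent tensor `T_{i,j,k}` and the
split distributions `γ_{X,i,j,k}, γ_{Y,i,j,k}, γ_{Z,i,j,k}`. [cite: VassilevskaWilliamsXuXuZhou2024, §5.5 (𝒯* = ⊗_{i+j+k} T_{i,j,k}^{⊗ A₁α(i,j,k)n}[γ_X, γ_Y, γ_Z])] -/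
def tripleTermList (c : ℕ) (γX γY γZ : ℕ × ℕ × ℕ → (Fin c → Fin 3) → ℝ) :
    Fin (constituentTriples c).card → InterfaceTerm c := fun s =>
  let ijk : ℕ × ℕ × ℕ := ((constituentTriples c).equivFin.symm s).1
  ⟨ijk.1, ijk.2.1, ijk.2.2, γX ijk, γY ijk, γZ ijk⟩

/-- The fibres of the term map are the position classes. [cite: VassilevskaWilliamsXuXuZhou2024, §5.3 and §5.5] -/
theorem filter_tripleTermMap_eq {I J K : Fin n → ℕ} (h : IsLevelTriple c I J K)
    (s : Fin (constituentTriples c).card) :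
    (univ.filter fun t => tripleTermMap h t = s) =
      posClass I J K ((constituentTriples c).equivFin.symm s).1.1 ((constituentTriples c).equivFin.symm s).1.2.1
        ((constituentTriples c).equivFin.symm s).1.2.2 := by
  ext t
  simp only [mem_filter, mem_univ, true_and, mem_posClass, tripleTermMap]
  rw [Equiv.apply_eq_iff_eq_symm_apply]
  constructor
  · intro ht
    have := congrArg Subtype.val ht
    simp only at this
    rw [← this]
    exact ⟨rfl, rfl, rfl⟩
  · rintro ⟨h1, h2, h3⟩
    apply Subtype.ext
    simp only
    rw [h1, h2, h3]

/-- **The level-1 `X`-blocks of `𝒯*` are the `X`-sequences in `X_I` useful for the triple**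
(`chunkLevels Î = I` and `split(Î, S_{i,j,k}) = γ_{X,i,j,k}` on occurring classes).
[cite: VassilevskaWilliamsXuXuZhou2024, Claim 5.11 (proof)] -/
theorem mem_levelBlocksX_triple_iff {I J K : Fin n → ℕ} (h : IsLevelTriple c I J K)
    (γX γY γZ : ℕ × ℕ × ℕ → (Fin c → Fin 3) → ℝ) (Ih : Fin n → Fin c → Fin 3) :
    Ih ∈ levelBlocksX (tripleTermMap h) (tripleTermList c γX γY γZ) 0 ↔
      chunkLevels Ih = I ∧ IsUsefulFor γX I J K Ih := by
  rw [levelBlocksX, mem_admissibleSeqs]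
  refine and_congr ?_ ?_
  · simp only [funext_iff, chunkLevels_apply, tripleTermList, tripleTermMap, Equiv.symm_apply_apply]
  · constructor
    · intro hc i j k hne
      by_cases hijk : i + j + k = 2 * c
      · let s := (constituentTriples c).equivFin ⟨(i, j, k), (mem_constituentTriples c).2 hijk⟩
        have hs : (univ.filter fun t => tripleTermMap h t = s) = posClass I J K i j k := by
          rw [filter_tripleTermMap_eq h s]; simp [s]
        have := hc s (by rw [hs]; exact hne)
        rw [hs, splitConsistentOn_zero_iff] at this
        simpa [tripleTermList, s] using this
      · exfalso
        rw [posClass_eq_empty h hijk] at hne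
        exact Finset.not_nonempty_empty hne
    · intro hu s hne
      rw [filter_tripleTermMap_eq h s] at hne ⊢
      rw [splitConsistentOn_zero_iff]
      exact hu _ _ _ hne

/-- The same for the `Y`-blocks. [cite: VassilevskaWilliamsXuXuZhou2024, Claim 5.11 (proof)] -/
theorem mem_levelBlocksY_triple_iff {I J K : Fin n → ℕ} (h : IsLevelTriple c I J K)
    (γX γY γZ : ℕ × ℕ × ℕ → (Fin c → Fin 3) → ℝ) (Jh : Fin n → Fin c → Fin 3) :
    Jh ∈ levelBlocksY (tripleTermMap h) (tripleTermList c γX γY γZ) 0 ↔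
      chunkLevels Jh = J ∧ IsUsefulFor γY I J K Jh := by
  rw [levelBlocksY, mem_admissibleSeqs]
  refine and_congr ?_ ?_
  · simp only [funext_iff, chunkLevels_apply, tripleTermList, tripleTermMap, Equiv.symm_apply_apply]
  · constructor
    · intro hc i j k hne
      by_cases hijk : i + j + k = 2 * c
      · let s := (constituentTriples c).equivFin ⟨(i, j, k), (mem_constituentTriples c).2 hijk⟩
        have hs : (univ.filter fun t => tripleTermMap h t = s) = posClass I J K i j k := by
          rw [filter_tripleTermMap_eq h s]; simp [s]
        have := hc s (by rw [hs]; exact hne)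
        rw [hs, splitConsistentOn_zero_iff] at this
        simpa [tripleTermList, s] using this
      · exfalso
        rw [posClass_eq_empty h hijk] at hne
        exact Finset.not_nonempty_empty hne
    · intro hu s hne
      rw [filter_tripleTermMap_eq h s] at hne ⊢
      rw [splitConsistentOn_zero_iff]
      exact hu _ _ _ hne

/-- The same for the `Z`-blocks. [cite: VassilevskaWilliamsXuXuZhou2024, Claim 5.11 (proof)] -/
theorem mem_levelBlocksZ_triple_iff {I J K : Fin n → ℕ} (h : IsLevelTriple c I J K)
    (γX γY γZ : ℕ × ℕ × ℕ → (Fin c → Fin 3) → ℝ) (Kh : Fin n → Fin c → Fin 3) :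
    Kh ∈ levelBlocksZ (tripleTermMap h) (tripleTermList c γX γY γZ) 0 ↔
      chunkLevels Kh = K ∧ IsUsefulFor γZ I J K Kh := by
  rw [levelBlocksZ, mem_admissibleSeqs]
  refine and_congr ?_ ?_
  · simp only [funext_iff, chunkLevels_apply, tripleTermList, tripleTermMap, Equiv.symm_apply_apply]
  · constructor
    · intro hc i j k hne
      by_cases hijk : i + j + k = 2 * c
      · let s := (constituentTriples c).equivFin ⟨(i, j, k), (mem_constituentTriples c).2 hijk⟩
        have hs : (univ.filter fun t => tripleTermMap h t = s) = posClass I J K i j k := by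
          rw [filter_tripleTermMap_eq h s]; simp [s]
        have := hc s (by rw [hs]; exact hne)
        rw [hs, splitConsistentOn_zero_iff] at this
        simpa [tripleTermList, s] using this
      · exfalso
        rw [posClass_eq_empty h hijk] at hne
        exact Finset.not_nonempty_empty hne
    · intro hu s hne
      rw [filter_tripleTermMap_eq h s] at hne ⊢
      rw [splitConsistentOn_zero_iff]
      exact hu _ _ _ hne

/-- **The useful sub-tensor over a block triple** (Claim 5.11's `𝒯'''|_{X_I Y_J Z_K}` without holes):
the zero-out of `(CW_q^{⊗c})^{⊗n}` keeping the level-1 `X`-blocks `Î ∈ X_I` useful for the triple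
(`split(Î, S_{i,j,k}) = γ_{X,i,j,k}`), and likewise for `Y`, `Z`. [cite: VassilevskaWilliamsXuXuZhou2024, §5.5 and Claim 5.11] -/
def usefulSubtensor (I J K : Fin n → ℕ) (γX γY γZ : ℕ × ℕ × ℕ → (Fin c → Fin 3) → ℝ) :
    (Fin n → Fin c → Fin (q + 2)) → (Fin n → Fin c → Fin (q + 2)) → (Fin n → Fin c → Fin (q + 2)) → R := by
  classical
  exact partSubtensor levelSeq levelSeq levelSeq (kroneckerPow (kroneckerPow (bigCwTensor R q) c) n)
    (univ.filter fun Ih => chunkLevels Ih = I ∧ IsUsefulFor γX I J K Ih)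
    (univ.filter fun Jh => chunkLevels Jh = J ∧ IsUsefulFor γY I J K Jh)
    (univ.filter fun Kh => chunkLevels Kh = K ∧ IsUsefulFor γZ I J K Kh)

/-- **VXXZ Claim 5.11, the identification**: "If there is no hole, then the subtensor of the
remaining tensor over `X_I Y_J Z_K` is isomorphic to `𝒯* = ⊗_{i+j+k=2^ℓ} T_{i,j,k}^{⊗ A₁α(i,j,k)n}[γ_X,γ_Y,γ_Z]`,
i.e., it is the level-`ℓ` interface tensor with parameter list
`{(A₁α(i,j,k)n, i, j, k, γ_{X,i,j,k}, γ_{Y,i,j,k}, γ_{Z,i,j,k})}_{i+j+k=2^ℓ}`" — here literally an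
equality with the interface tensor of term map `t ↦ (I_t, J_t, K_t)` (whose term `(i,j,k)` has
`|S_{i,j,k}|` chunks, `= A₁ α(i,j,k) n` for an `α`-consistent triple).
[cite: VassilevskaWilliamsXuXuZhou2024, Claim 5.11] -/
theorem usefulSubtensor_eq_interfaceTensor {I J K : Fin n → ℕ} (h : IsLevelTriple c I J K)
    (γX γY γZ : ℕ × ℕ × ℕ → (Fin c → Fin 3) → ℝ) :
    usefulSubtensor R q I J K γX γY γZ =
      interfaceTensor R q (tripleTermMap h) (tripleTermList c γX γY γZ) 0 := by
  classical
  funext x y z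
  simp only [usefulSubtensor, interfaceTensor, partSubtensor_apply, mem_filter, mem_univ, true_and,
    mem_levelBlocksX_triple_iff, mem_levelBlocksY_triple_iff, mem_levelBlocksZ_triple_iff]

end Identification

end Literature.Computability.AlgebraicComplexity
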